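import Mathlib.Data.ZMod.Basic
import Literature.Computability.AlgebraicComplexity.BrentEquations
import HarnessLib

/-!
# Hensel lifting of matrix multiplication schemes: the linear lifting step (KM 2023, §5)

Topic `Literature/Computability/AlgebraicComplexity`; companion of `BrentEquations.lean` (the Brent
system `brentSystem K n r`, `eval_brentSystem`). Source: M. Kauers, J. Moosbauer, *Flip Graphs for
Matrix Multiplication*, ISSAC 2023 = arXiv:2212.01175 (KM), §5:

"Knowing a solution valid mod `2^s` for some `s ∈ ℕ`, we can view it as an approximation to order `s`
of a solution valid in the `2`-adic integers, make an ansatz with undetermined coefficients for a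
refinement of this approximation to order `s+1`, plug this ansatz into the Brent equations, reduce
mod `2^{s+1}` and divide by `2^s`. This leads to a linear system over `ℤ₂` for the undetermined
coefficients in the ansatz, which can be solved with linear algebra. If it has no solution, this
proves that the approximation does not admit any refinement to order `s+1`. If it does have a
solution, we pick one and proceed to refine." (Hensel lifting / multivariate Newton iteration,
von zur Gathen–Gerhard §15.4: the linear system is the Jacobian system of the Brent equations at the
approximation.) Everything here is PROVED; there are no named facts.

## Contents

* `brentCubic x (i,j,k) = Σ_t x(0,t,i) x(1,t,j) x(2,t,k)` — the cubic part of the Brent equation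
  `(i,j,k)` at a point `x` (`eval_brentSystem_eq_brentCubic_sub`);
  `brentLinear x y (i,j,k) = Σ_t (y(0,t,i) x(1,t,j) x(2,t,k) + x(0,t,i) y(1,t,j) x(2,t,k) + x(0,t,i) x(1,t,j) y(2,t,k))`
  — its differential at `x` applied to `y` (the left-hand side of KM's linear system);
  `brentCubic_add_smul` — the exact expansion
  `B(x + h y) = B(x) + h·L_x(y) + h²·Q` (the equations are trilinear).
* `brent_refine_dvd_iff` — **the lifting step in divisibility form**: if `x` solves the Brent
  equations mod `q` with `B(x) = q·c`, and `p ∣ q` (so `pq ∣ q²`; KM: `p = 2`, `q = 2^s`, `s ≥ 1`),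
  then for EVERY `y`: `x + q·y` solves them mod `pq` iff `p ∣ c + L_x(y)` ("reduce mod `2^{s+1}` and
  divide by `2^s`").
* `kauersMoosbauer2023_hensel_step` — **KM §5 as printed** (`p = 2`): a solution mod `2^s`, `s ≥ 1`,
  admits a refinement `x + 2^s y` valid mod `2^{s+1}` iff the linear system
  `L_{x̄}(ȳ) = -c̄` over `ℤ₂` is solvable; `kauersMoosbauer2023_no_refinement` — "If it has no solution,
  this proves that the approximation does not admit any refinement to order `s+1`."
* `brent_refine_dvd_iff_zmod` — the same over `ZMod p` for any modulus `p ≥ 1` dividing `q`.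

Faithfulness notes. (1) KM's ansatz refines ALL coordinates by multiples of `2^s`; the equivalence is
stated for exactly these refinements `x + 2^s y`, `y` integral (as printed: "refinement of this
approximation to order `s+1`"). (2) "divide by `2^s`" is the passage from `2^{s+1} ∣ 2^s (c + L(y))`
to `2 ∣ c + L(y)`; the quadratic and cubic terms of the expansion carry a factor `2^{2s}`, divisible
by `2^{s+1}` because `s ≥ 1` — for `s = 0` the step is not linear, and the hypothesis `1 ≤ s` is
necessary. (3) The subsequent rational reconstruction and the experimental findings of §5 are not
formalised.

## References

* M. Kauers, J. Moosbauer, *Flip Graphs for Matrix Multiplication*, ISSAC 2023, 381–388,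
  doi:10.1145/3597066.3597120, arXiv:2212.01175, §5 (Hensel lifting of schemes found over `ℤ₂`).
  [KauersMoosbauer2022FlipGraphs]
* J. von zur Gathen, J. Gerhard, *Modern Computer Algebra*, 3rd ed., CUP 2013, §15.4 (Hensel lifting
  as multivariate Newton iteration; the Jacobian). [GathenGerhard2013]
* M. J. H. Heule, M. Kauers, M. Seidl, *New ways to multiply 3 × 3-matrices*, J. Symbolic Comput.
  104 (2021) 899–916, §2 (the Brent equations). [HeuleKauersSeidl2021]
-/

namespace Literature.Computability.AlgebraicComplexity

open scoped BigOperators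
open MvPolynomial

/-! ## §1 The cubic, its differential, and the exact expansion -/

section Expansion

variable {R : Type*} [CommRing R] {n r : ℕ}

/-- **The cubic part of the Brent equation `(i,j,k)`** at the point `x ∈ R^{3 × r × n²}`:
`Σ_{t<r} x(0,t,i)·x(1,t,j)·x(2,t,k)` (`= Σ_t α^{(t)}_i β^{(t)}_j γ^{(t)}_k`).
[cite: KauersMoosbauer2022FlipGraphs, §5 (the Brent equations)] -/
def brentCubic (x : Fin 3 × Fin r × (Fin n × Fin n) → R) (i j k : Fin n × Fin n) : R :=
  ∑ t : Fin r, x (0, t, i) * x (1, t, j) * x (2, t, k)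

/-- **The differential of the Brent cubic at `x`, applied to `y`** — the left-hand side of KM's
linear system for the undetermined coefficients `y` of the ansatz `x + 2^s y`:
`Σ_t (y(0,t,i) x(1,t,j) x(2,t,k) + x(0,t,i) y(1,t,j) x(2,t,k) + x(0,t,i) x(1,t,j) y(2,t,k))`.
[cite: KauersMoosbauer2022FlipGraphs, §5 ("a linear system over `ℤ₂` for the undetermined
coefficients in the ansatz")] -/
def brentLinear (x y : Fin 3 × Fin r × (Fin n × Fin n) → R) (i j k : Fin n × Fin n) : R :=
  ∑ t : Fin r, (y (0, t, i) * x (1, t, j) * x (2, t, k) + x (0, t, i) * y (1, t, j) * x (2, t, k) +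
    x (0, t, i) * x (1, t, j) * y (2, t, k))

/-- The terms of order `≥ 2` in `y` of `B(x + h y)`, divided by `h²`.
[cite: KauersMoosbauer2022FlipGraphs, §5 ("reduce mod `2^{s+1}`")] -/
def brentRemainder (x y : Fin 3 × Fin r × (Fin n × Fin n) → R) (h : R) (i j k : Fin n × Fin n) : R :=
  ∑ t : Fin r, (y (0, t, i) * y (1, t, j) * x (2, t, k) + y (0, t, i) * x (1, t, j) * y (2, t, k) +
    x (0, t, i) * y (1, t, j) * y (2, t, k) + h * (y (0, t, i) * y (1, t, j) * y (2, t, k)))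

/-- **The Brent equations are trilinear, so the ansatz expands exactly:**
`B(x + h·y) = B(x) + h·L_x(y) + h²·Q(x, y, h)`.
[cite: KauersMoosbauer2022FlipGraphs, §5 ("plug this ansatz into the Brent equations")] -/
theorem brentCubic_add_smul (x y : Fin 3 × Fin r × (Fin n × Fin n) → R) (h : R)
    (i j k : Fin n × Fin n) :
    brentCubic (x + h • y) i j k =
      brentCubic x i j k + h * brentLinear x y i j k + h ^ 2 * brentRemainder x y h i j k := by
  simp only [brentCubic, brentLinear, brentRemainder, Finset.mul_sum, ← Finset.sum_add_distrib]
  refine Finset.sum_congr rfl fun t _ => ?_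
  simp only [Pi.add_apply, Pi.smul_apply, smul_eq_mul]
  ring

/-- The Brent polynomial `(i,j,k)` evaluates at `x` to `brentCubic x (i,j,k) - ⟨n,n,n⟩_{ijk}`.
[cite: HeuleKauersSeidl2021, §2 (the Brent equations)] -/
theorem eval_brentSystem_eq_brentCubic_sub (x : Fin 3 × Fin r × (Fin n × Fin n) → R)
    (i j k : Fin n × Fin n) :
    eval x (brentSystem R n r i j k) = brentCubic x i j k - matMulTensor R n n n i j k := by
  rw [eval_brentSystem]
  simp only [brentCubic, Finset.sum_apply, triad_apply]

/-- `brentLinear` commutes with ring homomorphisms (reduction mod `p`).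
[cite: KauersMoosbauer2022FlipGraphs, §5 ("reduce mod `2^{s+1}`")] -/
theorem map_brentLinear {S : Type*} [CommRing S] (f : R →+* S)
    (x y : Fin 3 × Fin r × (Fin n × Fin n) → R) (i j k : Fin n × Fin n) :
    f (brentLinear x y i j k) = brentLinear (f ∘ x) (f ∘ y) i j k := by
  simp only [brentLinear, map_sum, map_add, map_mul, Function.comp_apply]

/-- Reduction of `L_x(y)` modulo `p`: `L_x(y) mod p = L_{x̄}(ȳ)`.
[cite: KauersMoosbauer2022FlipGraphs, §5 ("reduce mod `2^{s+1}`")] -/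
theorem intCast_brentLinear {S : Type*} [CommRing S] (x y : Fin 3 × Fin r × (Fin n × Fin n) → ℤ)
    (i j k : Fin n × Fin n) :
    ((brentLinear x y i j k : ℤ) : S) =
      brentLinear (fun v => (x v : S)) (fun v => (y v : S)) i j k :=
  map_brentLinear (Int.castRingHom S) x y i j k

end Expansion

/-! ## §2 The lifting step -/

section Lifting

variable {n r : ℕ}

/-- **The lifting step, divisibility form.** Let `x` solve the Brent equations modulo `q`, say
`B_{ijk}(x) - ⟨n,n,n⟩_{ijk} = q·c_{ijk}`, and let `p ∣ q`, `q ≠ 0` (KM: `p = 2`, `q = 2^s` with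
`s ≥ 1`). Then for every integral `y`, the refinement `x + q·y` solves the equations modulo `p·q`
iff `p ∣ c_{ijk} + L_x(y)_{ijk}` — "plug this ansatz into the Brent equations, reduce mod `2^{s+1}`
and divide by `2^s`. This leads to a linear system over `ℤ₂`". [cite: KauersMoosbauer2022FlipGraphs, §5] -/
theorem brent_refine_dvd_iff {p q : ℤ} (hq : q ≠ 0) (hpq : p ∣ q)
    (x y : Fin 3 × Fin r × (Fin n × Fin n) → ℤ)
    (c : (Fin n × Fin n) → (Fin n × Fin n) → (Fin n × Fin n) → ℤ)
    (hx : ∀ i j k, eval x (brentSystem ℤ n r i j k) = q * c i j k) (i j k : Fin n × Fin n) :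
    p * q ∣ eval (x + q • y) (brentSystem ℤ n r i j k) ↔ p ∣ c i j k + brentLinear x y i j k := by
  have hexp : eval (x + q • y) (brentSystem ℤ n r i j k) =
      q * (c i j k + brentLinear x y i j k + q * brentRemainder x y q i j k) := by
    have h0 := hx i j k
    rw [eval_brentSystem_eq_brentCubic_sub] at h0 ⊢
    rw [brentCubic_add_smul]
    linear_combination h0
  rw [hexp, mul_comm p q, mul_dvd_mul_iff_left hq]
  constructor
  · intro h
    have h' := dvd_sub h (dvd_mul_of_dvd_left hpq (brentRemainder x y q i j k))
    rwa [add_sub_cancel_right] at h'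
  · intro h
    exact dvd_add h (dvd_mul_of_dvd_left hpq _)

/-- **The lifting step over `ZMod p`:** with `x̄, ȳ, c̄` the reductions mod `p`, the refinement
`x + q·y` is valid mod `p·q` iff `L_{x̄}(ȳ) = -c̄` in `ℤ/p` — the linear system for the undetermined
coefficients. [cite: KauersMoosbauer2022FlipGraphs, §5 ("a linear system over `ℤ₂`")] -/
theorem brent_refine_dvd_iff_zmod {p : ℕ} [NeZero p] {q : ℤ} (hq : q ≠ 0) (hpq : (p : ℤ) ∣ q)
    (x y : Fin 3 × Fin r × (Fin n × Fin n) → ℤ)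
    (c : (Fin n × Fin n) → (Fin n × Fin n) → (Fin n × Fin n) → ℤ)
    (hx : ∀ i j k, eval x (brentSystem ℤ n r i j k) = q * c i j k) (i j k : Fin n × Fin n) :
    (p : ℤ) * q ∣ eval (x + q • y) (brentSystem ℤ n r i j k) ↔
      brentLinear (fun v => (x v : ZMod p)) (fun v => (y v : ZMod p)) i j k = -(c i j k : ZMod p) := by
  rw [brent_refine_dvd_iff hq hpq x y c hx, ← ZMod.intCast_zmod_eq_zero_iff_dvd, Int.cast_add,
    intCast_brentLinear, add_comm, add_eq_zero_iff_eq_neg]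

/-- **KM §5, the Hensel lifting step as printed (`p = 2`).** Let `x` be a solution of the Brent
equations valid mod `2^s`, `s ≥ 1`, with `B(x) - ⟨n,n,n⟩ = 2^s·c`. Then the approximation admits a
refinement `x + 2^s·y` to order `s+1` (valid mod `2^{s+1}`) if and only if the linear system
`L_{x̄}(ȳ) = -c̄` over `ℤ₂` (unknowns `ȳ ∈ ℤ₂^{3rn²}`) has a solution.
[cite: KauersMoosbauer2022FlipGraphs, §5] -/
theorem kauersMoosbauer2023_hensel_step {s : ℕ} (hs : 1 ≤ s)
    (x : Fin 3 × Fin r × (Fin n × Fin n) → ℤ)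
    (c : (Fin n × Fin n) → (Fin n × Fin n) → (Fin n × Fin n) → ℤ)
    (hx : ∀ i j k, eval x (brentSystem ℤ n r i j k) = 2 ^ s * c i j k) :
    (∃ y : Fin 3 × Fin r × (Fin n × Fin n) → ℤ,
        ∀ i j k, (2 : ℤ) ^ (s + 1) ∣ eval (x + (2 : ℤ) ^ s • y) (brentSystem ℤ n r i j k)) ↔
      ∃ ybar : Fin 3 × Fin r × (Fin n × Fin n) → ZMod 2,
        ∀ i j k, brentLinear (fun v => (x v : ZMod 2)) ybar i j k = -(c i j k : ZMod 2) := by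
  have hq : (2 : ℤ) ^ s ≠ 0 := pow_ne_zero s two_ne_zero
  have hpq : ((2 : ℕ) : ℤ) ∣ (2 : ℤ) ^ s := dvd_pow_self 2 (by omega)
  have hpow : (2 : ℤ) ^ (s + 1) = ((2 : ℕ) : ℤ) * 2 ^ s := by rw [pow_succ, mul_comm]; rfl
  constructor
  · rintro ⟨y, hy⟩
    refine ⟨fun v => (y v : ZMod 2), fun i j k => ?_⟩
    rw [← brent_refine_dvd_iff_zmod hq hpq x y c hx i j k, ← hpow]
    exact hy i j k
  · rintro ⟨ybar, hybar⟩
    refine ⟨fun v => ((ybar v).val : ℤ), fun i j k => ?_⟩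
    rw [hpow, brent_refine_dvd_iff_zmod hq hpq x _ c hx i j k]
    have e : (fun v => (((ybar v).val : ℤ) : ZMod 2)) = ybar := by
      funext v
      rw [Int.cast_natCast, ZMod.natCast_zmod_val]
    rw [e]
    exact hybar i j k

/-- **"If it has no solution, this proves that the approximation does not admit any refinement to
order `s+1`."** [cite: KauersMoosbauer2022FlipGraphs, §5] -/
theorem kauersMoosbauer2023_no_refinement {s : ℕ} (hs : 1 ≤ s)
    (x : Fin 3 × Fin r × (Fin n × Fin n) → ℤ)
    (c : (Fin n × Fin n) → (Fin n × Fin n) → (Fin n × Fin n) → ℤ)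
    (hx : ∀ i j k, eval x (brentSystem ℤ n r i j k) = 2 ^ s * c i j k)
    (hno : ¬ ∃ ybar : Fin 3 × Fin r × (Fin n × Fin n) → ZMod 2,
        ∀ i j k, brentLinear (fun v => (x v : ZMod 2)) ybar i j k = -(c i j k : ZMod 2))
    (y : Fin 3 × Fin r × (Fin n × Fin n) → ℤ) :
    ∃ i j k, ¬ (2 : ℤ) ^ (s + 1) ∣ eval (x + (2 : ℤ) ^ s • y) (brentSystem ℤ n r i j k) := by
  by_contra h
  push Not at h
  exact hno ((kauersMoosbauer2023_hensel_step hs x c hx).mp ⟨y, h⟩)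

/-- A solution valid mod `2^{s+1}` reduces to the decomposition problem: if the refinement is EXACT
(`B(x + 2^s y) = ⟨n,n,n⟩` over `ℤ`), then `R_ℤ(⟨n,n,n⟩) ≤ r` — the end of the lifting chain ("whether
the candidate solution over `ℚ` or even `ℤ` is indeed a solution, can be checked easily by plugging
it into the Brent equations"). [cite: KauersMoosbauer2022FlipGraphs, §5] -/
theorem tensorRank_le_of_exact_refinement (x y : Fin 3 × Fin r × (Fin n × Fin n) → ℤ) (q : ℤ)
    (h : ∀ i j k, eval (x + q • y) (brentSystem ℤ n r i j k) = 0) :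
    tensorRank (matMulTensor ℤ n n n) ≤ r :=
  tensorRank_le_of_eval_brentSystem_eq_zero _ h

end Lifting

/-! ## §3 The linear system as a matrix (the Jacobian) and certificates of non-liftability -/

section Jacobian

variable {R : Type*} [CommRing R] {n r : ℕ}

/-- **The Jacobian of the Brent equations at `x`**: the entry `(ijk, v)` is `∂B_{ijk}/∂X_v (x)`, i.e.
for `v = (0,t,i')`: `[i' = i]·x(1,t,j)·x(2,t,k)`, for `v = (1,t,j')`: `[j' = j]·x(0,t,i)·x(2,t,k)`, for
`v = (2,t,k')`: `[k' = k]·x(0,t,i)·x(1,t,j)` — the coefficient matrix of KM's linear system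
(von zur Gathen–Gerhard §15.4: multivariate Newton iteration with the Jacobian `J = (∂φ_i/∂y_j)`).
[cite: GathenGerhard2013, §15.4 (multivariate Newton iteration, the Jacobian)] -/
def brentJacobian (x : Fin 3 × Fin r × (Fin n × Fin n) → R) (i j k : Fin n × Fin n)
    (v : Fin 3 × Fin r × (Fin n × Fin n)) : R :=
  (if v.1 = 0 ∧ v.2.2 = i then x (1, v.2.1, j) * x (2, v.2.1, k) else 0) +
    (if v.1 = 1 ∧ v.2.2 = j then x (0, v.2.1, i) * x (2, v.2.1, k) else 0) +
    (if v.1 = 2 ∧ v.2.2 = k then x (0, v.2.1, i) * x (1, v.2.1, j) else 0)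

/-- One block of the Jacobian system: `Σ_{(t,a)} [a = a₀]·E_t·y(m,t,a) = Σ_t E_t·y(m,t,a₀)`. [folklore] -/
private theorem block_sum (E : Fin r → R) (y : Fin 3 × Fin r × (Fin n × Fin n) → R) (m : Fin 3)
    (a₀ : Fin n × Fin n) :
    ∑ ta : Fin r × (Fin n × Fin n), (if ta.2 = a₀ then E ta.1 else 0) * y (m, ta) =
      ∑ t, E t * y (m, t, a₀) := by
  rw [Fintype.sum_prod_type]
  refine Finset.sum_congr rfl fun t _ => ?_
  simp only [ite_mul, zero_mul, Finset.sum_ite_eq', Finset.mem_univ, if_true]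

/-- **KM's linear system is the Jacobian system:** `L_x(y)_{ijk} = Σ_v J(x)_{ijk,v} · y_v`.
[cite: KauersMoosbauer2022FlipGraphs, §5 ("a linear system over `ℤ₂` for the undetermined
coefficients")] -/
theorem brentLinear_eq_sum_jacobian (x y : Fin 3 × Fin r × (Fin n × Fin n) → R)
    (i j k : Fin n × Fin n) :
    brentLinear x y i j k = ∑ v, brentJacobian x i j k v * y v := by
  have h01 : ((0 : Fin 3) = 1) = False := by decide
  have h02 : ((0 : Fin 3) = 2) = False := by decide
  have h10 : ((1 : Fin 3) = 0) = False := by decide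
  have h12 : ((1 : Fin 3) = 2) = False := by decide
  have h20 : ((2 : Fin 3) = 0) = False := by decide
  have h21 : ((2 : Fin 3) = 1) = False := by decide
  rw [Fintype.sum_prod_type, Fin.sum_univ_three]
  simp only [brentJacobian, h01, h02, h10, h12, h20, h21, true_and, false_and, if_false, add_zero,
    zero_add]
  rw [block_sum (fun t => x (1, t, j) * x (2, t, k)) y 0 i,
    block_sum (fun t => x (0, t, i) * x (2, t, k)) y 1 j,
    block_sum (fun t => x (0, t, i) * x (1, t, j)) y 2 k,
    brentLinear, ← Finset.sum_add_distrib, ← Finset.sum_add_distrib]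
  refine Finset.sum_congr rfl fun t _ => ?_
  ring

/-- **A certificate that the linear system has no solution** (hence, by
`kauersMoosbauer2023_hensel_step`, that the approximation admits no refinement): a vector `λ` over
`ℤ/p` with `λᵀ J(x̄) = 0` and `λᵀ c̄ ≠ 0`. ("can be solved with linear algebra. If it has no solution,
this proves that the approximation does not admit any refinement to order `s+1`.")
[cite: KauersMoosbauer2022FlipGraphs, §5] -/
theorem not_exists_brentLinear_eq_of_dual {p : ℕ} (xbar : Fin 3 × Fin r × (Fin n × Fin n) → ZMod p)
    (cbar : (Fin n × Fin n) → (Fin n × Fin n) → (Fin n × Fin n) → ZMod p)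
    (lam : (Fin n × Fin n) → (Fin n × Fin n) → (Fin n × Fin n) → ZMod p)
    (hJ : ∀ v, ∑ i, ∑ j, ∑ k, lam i j k * brentJacobian xbar i j k v = 0)
    (hc : ∑ i, ∑ j, ∑ k, lam i j k * cbar i j k ≠ 0) :
    ¬ ∃ ybar : Fin 3 × Fin r × (Fin n × Fin n) → ZMod p,
        ∀ i j k, brentLinear xbar ybar i j k = -cbar i j k := by
  rintro ⟨ybar, hy⟩
  apply hc
  have hcL : ∀ i j k, lam i j k * cbar i j k =
      -∑ v, lam i j k * brentJacobian xbar i j k v * ybar v := by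
    intro i j k
    have e : cbar i j k = -∑ v, brentJacobian xbar i j k v * ybar v := by
      rw [← brentLinear_eq_sum_jacobian, hy, neg_neg]
    rw [e, mul_neg, Finset.mul_sum]
    simp_rw [← mul_assoc]
  simp_rw [hcL, Finset.sum_neg_distrib, neg_eq_zero]
  -- move the sum over `v` outside and use `λᵀ J = 0` column by column
  have e1 : ∑ i, ∑ j, ∑ k, ∑ v, lam i j k * brentJacobian xbar i j k v * ybar v =
      ∑ i, ∑ j, ∑ v, ∑ k, lam i j k * brentJacobian xbar i j k v * ybar v :=
    Finset.sum_congr rfl fun i _ => Finset.sum_congr rfl fun j _ => Finset.sum_comm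
  have e2 : ∑ i, ∑ j, ∑ v, ∑ k, lam i j k * brentJacobian xbar i j k v * ybar v =
      ∑ i, ∑ v, ∑ j, ∑ k, lam i j k * brentJacobian xbar i j k v * ybar v :=
    Finset.sum_congr rfl fun i _ => Finset.sum_comm
  have e3 : ∑ i, ∑ v, ∑ j, ∑ k, lam i j k * brentJacobian xbar i j k v * ybar v =
      ∑ v, ∑ i, ∑ j, ∑ k, lam i j k * brentJacobian xbar i j k v * ybar v :=
    Finset.sum_comm
  rw [e1, e2, e3]
  simp_rw [← Finset.sum_mul, hJ, zero_mul, Finset.sum_const_zero]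

/-- **Hence a dual certificate proves non-liftability** (KM §5 with `p = 2`): no refinement
`x + 2^s y` of the approximation `x` is valid mod `2^{s+1}`.
[cite: KauersMoosbauer2022FlipGraphs, §5 ("If it has no solution, this proves that the
approximation does not admit any refinement to order `s+1`")] -/
theorem kauersMoosbauer2023_no_refinement_of_dual {s : ℕ} (hs : 1 ≤ s)
    (x : Fin 3 × Fin r × (Fin n × Fin n) → ℤ)
    (c : (Fin n × Fin n) → (Fin n × Fin n) → (Fin n × Fin n) → ℤ)
    (hx : ∀ i j k, eval x (brentSystem ℤ n r i j k) = 2 ^ s * c i j k)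
    (lam : (Fin n × Fin n) → (Fin n × Fin n) → (Fin n × Fin n) → ZMod 2)
    (hJ : ∀ v, ∑ i, ∑ j, ∑ k, lam i j k * brentJacobian (fun v => (x v : ZMod 2)) i j k v = 0)
    (hc : ∑ i, ∑ j, ∑ k, lam i j k * (c i j k : ZMod 2) ≠ 0)
    (y : Fin 3 × Fin r × (Fin n × Fin n) → ℤ) :
    ∃ i j k, ¬ (2 : ℤ) ^ (s + 1) ∣ eval (x + (2 : ℤ) ^ s • y) (brentSystem ℤ n r i j k) :=
  kauersMoosbauer2023_no_refinement hs x c hx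
    (not_exists_brentLinear_eq_of_dual _ (fun i j k => (c i j k : ZMod 2)) lam hJ hc) y

end Jacobian

end Literature.Computability.AlgebraicComplexity
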